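import Literature.Analysis.FluidPDE.TaoClassSliceData
import Literature.Analysis.FluidPDE.SwirlTransportProofs
import HarnessLib

/-!
# The `L⁴` balance of `v^θ` along a Tao-class axisymmetric solution

Analysis/FluidPDE support file (theorems only; no definitions, no named facts) on the discharge
path of the named fact `Literature.Analysis.FluidPDE.LeiZhang2017_logModulus_regularity`
(Lei–Zhang 2017, arXiv:1505.02628, §3, p. 9, the `L⁴` estimate of `v^θ`, integrated in time).

With `Γ = swirl`, `Φ = angVelQuot` (`(v^θ)² = ΓΦ`, `(v^θ)⁴ = Γ²Φ²`), along a Tao-class solution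
`v` on `[0, T]` with axisymmetric slices and bounded swirl `|Γ| ≤ M`:

* `IsTaoSolutionOn.memLp_angVelQuot_data` — `Φ, ∂ᵢΦ, ∂ᵢ∂ᵢΦ, radDerivQuot Φ ∈ L²` at each time;
* `IsTaoSolutionOn.integral_swirlSq_angVelQuotSq_eq` — for `b ∈ (0, T]`,
  `∫ Γ(b)²Φ(b)² = ∫ Γ(0)²Φ(0)² + 4∫_{(0,b)} ∫ Γ²Φ Φ'` with `Φ' = angVelQuot (∂ₜv)`, together with the
  integrability of `t ↦ ∫ Γ²ΦΦ'` on `(0, T)` (off-axis time lines `ΓΦ = r⁻²⟪Jx, v⟫²`,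
  `SqIntegralBalance`).

## References

* Z. Lei, Q. S. Zhang, Pacific J. Math. 289 (2017) 169–187, arXiv:1505.02628, §3, p. 9. [`LeiZhang2017`]
-/

noncomputable section

open MeasureTheory Set Function Filter Topology InnerProductSpace WithLp
open scoped RealInnerProductSpace ContDiff ENNReal NNReal Topology

namespace Literature.Analysis.FluidPDE

section Data

variable {T ν : ℝ} {u₀ : EuclideanSpace ℝ (Fin 3) → EuclideanSpace ℝ (Fin 3)}
  {v : ℝ → EuclideanSpace ℝ (Fin 3) → EuclideanSpace ℝ (Fin 3)} {q : ℝ → EuclideanSpace ℝ (Fin 3) → ℝ}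

/-- **`L²` data of `Φ = angVelQuot (v t)`** along a Tao-class solution with axisymmetric slices:
`Φ, ∂ᵢΦ, ∂ᵢ∂ᵢΦ, radDerivQuot Φ ∈ L²`. [folklore] -/
theorem IsTaoSolutionOn.memLp_angVelQuot_data (h : IsTaoSolutionOn T ν u₀ v q)
    (hax : ∀ t ∈ Icc 0 T, IsAxisymmetric (v t)) {t : ℝ} (ht : t ∈ Icc 0 T) :
    MemLp (angVelQuot (v t)) 2 volume ∧
    (∀ i : Fin 3, MemLp (fun x => fderiv ℝ (angVelQuot (v t)) x (EuclideanSpace.single i 1)) 2 volume) ∧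
    (∀ i : Fin 3, MemLp (fun x => fderiv ℝ (fun y => fderiv ℝ (angVelQuot (v t)) y
      (EuclideanSpace.single i 1)) x (EuclideanSpace.single i 1)) 2 volume) ∧
    MemLp (radDerivQuot (angVelQuot (v t))) 2 volume := by
  have hvs : ∀ s ∈ Icc 0 T, ContDiff ℝ ∞ (v s) := fun s hs => h.classical.contDiff_velocity hs
  obtain ⟨C0, hC0⟩ := exists_lintegral_sq_iteratedFDeriv_angVelQuot_le hvs hax h.sobolev 0
  obtain ⟨C1, hC1⟩ := exists_lintegral_sq_iteratedFDeriv_angVelQuot_le hvs hax h.sobolev 1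
  obtain ⟨C2, hC2⟩ := exists_lintegral_sq_iteratedFDeriv_angVelQuot_le hvs hax h.sobolev 2
  set Φ := angVelQuot (v t) with hΦ
  have hΦc : ContDiff ℝ ∞ Φ := contDiff_angVelQuot (by simpa using hvs t ht)
  have hΦ2 : ContDiff ℝ 2 Φ := hΦc.of_le (by norm_cast)
  have hΦ1 : ContDiff ℝ 1 Φ := hΦc.of_le (by norm_cast)
  have m0 : MemLp Φ 2 volume :=
    memLp_two_of_norm_le_coe (F := fun x => iteratedFDeriv ℝ 0 Φ x) hΦc.continuous
      (fun x => by rw [norm_iteratedFDeriv_zero]) (hC0 t ht)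
  have m1 : ∀ i : Fin 3, MemLp (fun x => fderiv ℝ Φ x (EuclideanSpace.single i 1)) 2 volume := fun i =>
    memLp_two_of_norm_le_coe (F := fun x => iteratedFDeriv ℝ 1 Φ x)
      ((hΦ1.continuous_fderiv one_ne_zero).clm_apply continuous_const)
      (fun x => norm_fderiv_apply_single_le_iteratedFDeriv Φ x i) (hC1 t ht)
  have m2 : ∀ i : Fin 3, MemLp (fun x => fderiv ℝ (fun y => fderiv ℝ Φ y (EuclideanSpace.single i 1)) x
      (EuclideanSpace.single i 1)) 2 volume := fun i =>
    memLp_two_of_norm_le_coe (F := fun x => iteratedFDeriv ℝ 2 Φ x)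
      (((contDiff_fderiv_apply_const_succ (n := 1) (by exact_mod_cast hΦ2) _).continuous_fderiv
        one_ne_zero).clm_apply continuous_const)
      (fun x => norm_fderiv_fderiv_apply_single_le_iteratedFDeriv hΦ2 x i i) (hC2 t ht)
  exact ⟨m0, m1, m2, (memLp_radDerivQuot_of_memLp hΦ2 (m2 0)).1⟩

end Data

section Balance

variable {T ν : ℝ} {u₀ : EuclideanSpace ℝ (Fin 3) → EuclideanSpace ℝ (Fin 3)}
  {v : ℝ → EuclideanSpace ℝ (Fin 3) → EuclideanSpace ℝ (Fin 3)} {q : ℝ → EuclideanSpace ℝ (Fin 3) → ℝ}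

/-- **The `L⁴` balance of `v^θ`** (`(v^θ)⁴ = Γ²Φ²`) along a Tao-class solution with axisymmetric
slices and bounded swirl `|Γ(t,x)| ≤ M` on `[0, T]`: the pairing `t ↦ ∫ Γ²Φ Φ'`
(`Φ' = angVelQuot (∂ₜv)`) is integrable on `(0, T)`, and for `b ∈ (0, T]`,
`∫ Γ(b)²Φ(b)² = ∫ Γ(0)²Φ(0)² + 4 ∫_{(0,b)} ∫ Γ²Φ Φ'`. [cite: LeiZhang2017, §3, p. 9] -/
theorem IsTaoSolutionOn.integral_swirlSq_angVelQuotSq_eq (h : IsTaoSolutionOn T ν u₀ v q) (hT : 0 < T)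
    (hax : ∀ t ∈ Icc 0 T, IsAxisymmetric (v t)) {M : ℝ} (hbd : ∀ t ∈ Icc 0 T, ∀ x, |swirl (v t) x| ≤ M) :
    IntegrableOn (fun t => ∫ x, swirl (v t) x ^ 2 * angVelQuot (v t) x *
      angVelQuot (timeDerivWithin (Icc 0 T) v t) x) (Ioo 0 T) ∧
    ∀ b ∈ Ioc 0 T, ∫ x, swirl (v b) x ^ 2 * angVelQuot (v b) x ^ 2 =
      (∫ x, swirl (v 0) x ^ 2 * angVelQuot (v 0) x ^ 2) +
        4 * ∫ t in Ioo 0 b, ∫ x, swirl (v t) x ^ 2 * angVelQuot (v t) x *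
          angVelQuot (timeDerivWithin (Icc 0 T) v t) x := by
  have hU : UniqueDiffOn ℝ (Icc 0 T) := uniqueDiffOn_Icc hT
  have hsm : IsSmoothSpaceTimeOn (Icc 0 T) v := h.classical.smooth_velocity
  set w := timeDerivWithin (Icc 0 T) v with hw
  have hwsm : IsSmoothSpaceTimeOn (Icc 0 T) w := hsm.timeDerivWithin hU
  have hvs : ∀ t ∈ Icc 0 T, ContDiff ℝ ∞ (v t) := fun t ht => h.classical.contDiff_velocity ht
  have hws : ∀ t ∈ Icc 0 T, ContDiff ℝ ∞ (w t) := fun t ht => hsm.contDiff_timeDerivWithin_slice hU ht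
  have hwax : ∀ t ∈ Icc 0 T, IsAxisymmetric (w t) := fun t ht => hsm.isAxisymmetric_timeDerivWithin hax ht
  have hM0 : 0 ≤ M := (abs_nonneg _).trans (hbd 0 ⟨le_rfl, hT.le⟩ 0)
  -- the functions
  set g : ℝ → EuclideanSpace ℝ (Fin 3) → ℝ := fun t x => swirl (v t) x * angVelQuot (v t) x with hg
  set g' : ℝ → EuclideanSpace ℝ (Fin 3) → ℝ := fun t x =>
    2 * angVelQuot (v t) x * swirl (w t) x with hg'
  -- representations off the axis
  have hΦrep : ∀ t ∈ Icc 0 T, ∀ x, cylRadius x ≠ 0 →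
      angVelQuot (v t) x = (cylRadius x ^ 2)⁻¹ * ⟪rotGen x, v t x⟫ := by
    intro t ht x hx
    have e := (hax t ht).cylRadius_sq_mul_angVelQuot ((hvs t ht).of_le (by norm_cast)) x
    rw [swirl_eq_inner_rotGen] at e
    simp only at e
    rw [← e, ← mul_assoc, inv_mul_cancel₀ (pow_ne_zero 2 hx), one_mul]
  have hΓrep : ∀ t x, swirl (v t) x = ⟪rotGen x, v t x⟫ := fun t x => by rw [swirl_eq_inner_rotGen]
  have hΓ'rep : ∀ t x, swirl (w t) x = ⟪rotGen x, w t x⟫ := fun t x => by rw [swirl_eq_inner_rotGen]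
  have hgrep : ∀ t ∈ Icc 0 T, ∀ x, cylRadius x ≠ 0 →
      g t x = (cylRadius x ^ 2)⁻¹ * ⟪rotGen x, v t x⟫ ^ 2 := by
    intro t ht x hx; simp only [hg]; rw [hΦrep t ht x hx, hΓrep]; ring
  have hg'rep : ∀ t ∈ Icc 0 T, ∀ x, cylRadius x ≠ 0 →
      g' t x = 2 * ((cylRadius x ^ 2)⁻¹ * ⟪rotGen x, v t x⟫) * ⟪rotGen x, w t x⟫ := by
    intro t ht x hx; simp only [hg']; rw [hΦrep t ht x hx, hΓ'rep]
  -- `g g' = 2 Γ²Φ Φ'` on `[0, T]`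
  have hgg' : ∀ t ∈ Icc 0 T, ∀ x, g t x * g' t x =
      2 * (swirl (v t) x ^ 2 * angVelQuot (v t) x * angVelQuot (w t) x) := by
    intro t ht x
    have e1 := (hax t ht).cylRadius_sq_mul_angVelQuot ((hvs t ht).of_le (by norm_cast)) x
    have e2 := (hwax t ht).cylRadius_sq_mul_angVelQuot ((hws t ht).of_le (by norm_cast)) x
    simp only [hg, hg']
    rw [← e2]
    have : swirl (v t) x ^ 2 = swirl (v t) x * (cylRadius x ^ 2 * angVelQuot (v t) x) := by rw [e1, sq]
    rw [this]; ring
  -- uniform `L²` bounds of `Φ(t)`, `Φ'(t)`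
  obtain ⟨C₁, hC₁⟩ := exists_lintegral_sq_iteratedFDeriv_angVelQuot_le hvs hax h.sobolev 0
  obtain ⟨C₂, hC₂⟩ := exists_lintegral_sq_iteratedFDeriv_angVelQuot_le hws hwax h.sobolev_dt 0
  have e0 : ∀ (f : EuclideanSpace ℝ (Fin 3) → ℝ), ∫⁻ x, ‖f x‖ₑ ^ 2 = ∫⁻ x, ‖iteratedFDeriv ℝ 0 f x‖ₑ ^ 2 :=
    fun f => lintegral_congr fun x => by rw [← ofReal_norm, ← ofReal_norm, norm_iteratedFDeriv_zero]
  have hΦb : ∀ t ∈ Icc 0 T, ∫⁻ x, ‖angVelQuot (v t) x‖ₑ ^ 2 ≤ C₁ := fun t ht => by rw [e0]; exact hC₁ t ht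
  have hΦ'b : ∀ t ∈ Icc 0 T, ∫⁻ x, ‖angVelQuot (w t) x‖ₑ ^ 2 ≤ C₂ := fun t ht => by rw [e0]; exact hC₂ t ht
  -- continuity of slices
  have hΦc : ∀ t ∈ Icc 0 T, Continuous (angVelQuot (v t)) := fun t ht =>
    (contDiff_angVelQuot (n := 0) (by exact_mod_cast (hvs t ht).of_le (by norm_cast))).continuous
  have hΦ'c : ∀ t ∈ Icc 0 T, Continuous (angVelQuot (w t)) := fun t ht =>
    (contDiff_angVelQuot (n := 0) (by exact_mod_cast (hws t ht).of_le (by norm_cast))).continuous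
  have hΓc : ∀ t ∈ Icc 0 T, Continuous (swirl (v t)) := fun t ht => by
    rw [swirl_eq_inner_rotGen]; exact (rotGenL.continuous).inner (hvs t ht).continuous
  -- the uniform `L¹` bound of `g g'`
  have hbound : ∀ t ∈ Icc 0 T, ∫⁻ x, ‖g t x * g' t x‖ₑ ≤ ENNReal.ofReal (2 * M ^ 2) * (C₁ + C₂) := by
    intro t ht
    calc ∫⁻ x, ‖g t x * g' t x‖ₑ
        ≤ ∫⁻ x, ENNReal.ofReal (2 * M ^ 2) * (‖angVelQuot (v t) x‖ₑ * ‖angVelQuot (w t) x‖ₑ) := by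
          refine lintegral_mono fun x => ?_
          rw [hgg' t ht x, ← ofReal_norm, ← ofReal_norm, ← ofReal_norm,
            ← ENNReal.ofReal_mul (norm_nonneg _), ← ENNReal.ofReal_mul (by positivity)]
          refine ENNReal.ofReal_le_ofReal ?_
          rw [Real.norm_eq_abs, Real.norm_eq_abs, Real.norm_eq_abs, abs_mul, abs_mul, abs_mul, abs_two,
            abs_of_nonneg (sq_nonneg _)]
          have h1 : swirl (v t) x ^ 2 ≤ M ^ 2 := by
            rw [← sq_abs]; exact pow_le_pow_left₀ (abs_nonneg _) (hbd t ht x) 2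
          have := mul_nonneg (abs_nonneg (angVelQuot (v t) x)) (abs_nonneg (angVelQuot (w t) x))
          nlinarith
      _ = ENNReal.ofReal (2 * M ^ 2) * ∫⁻ x, ‖angVelQuot (v t) x‖ₑ * ‖angVelQuot (w t) x‖ₑ := by
          rw [lintegral_const_mul' _ _ ENNReal.ofReal_ne_top]
      _ ≤ ENNReal.ofReal (2 * M ^ 2) * ((∫⁻ x, ‖angVelQuot (v t) x‖ₑ ^ 2) + ∫⁻ x, ‖angVelQuot (w t) x‖ₑ ^ 2) := by
          gcongr
          calc ∫⁻ x, ‖angVelQuot (v t) x‖ₑ * ‖angVelQuot (w t) x‖ₑ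
              ≤ ∫⁻ x, (‖angVelQuot (v t) x‖ₑ ^ 2 + ‖angVelQuot (w t) x‖ₑ ^ 2) :=
                lintegral_mono fun x => ennreal_mul_le_sq_add_sq _ _
            _ = _ := lintegral_add_left (((hΦc t ht).measurable.enorm.pow_const 2)) _
      _ ≤ ENNReal.ofReal (2 * M ^ 2) * (C₁ + C₂) := by
          gcongr
          · exact hΦb t ht
          · exact hΦ'b t ht
  -- joint measurability from continuity off the axis
  have hmeas : AEStronglyMeasurable (uncurry fun t x => g t x * g' t x)
      ((volume.restrict (Ioo 0 T)).prod volume) := by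
    refine aestronglyMeasurable_prod_of_continuousOn_off_axis (F := uncurry fun t x => g t x * g' t x) ?_
    have cv : ContinuousOn (uncurry v) (Icc 0 T ×ˢ univ) := hsm.continuousOn
    have cw : ContinuousOn (uncurry w) (Icc 0 T ×ˢ univ) := hwsm.continuousOn
    have hsub : Ioo 0 T ×ˢ {x : EuclideanSpace ℝ (Fin 3) | cylRadius x ≠ 0} ⊆ Icc 0 T ×ˢ univ :=
      prod_mono Ioo_subset_Icc_self (subset_univ _)
    have cr : ContinuousOn (fun p : ℝ × EuclideanSpace ℝ (Fin 3) => (cylRadius p.2 ^ 2)⁻¹)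
        (Ioo 0 T ×ˢ {x | cylRadius x ≠ 0}) := by
      refine ((continuous_cylRadius.comp continuous_snd).pow 2).continuousOn.inv₀ fun p hp => ?_
      exact pow_ne_zero 2 hp.2
    have ca : Continuous fun p : ℝ × EuclideanSpace ℝ (Fin 3) => rotGen p.2 := rotGenL.continuous.comp continuous_snd
    have cF : ContinuousOn (fun p : ℝ × EuclideanSpace ℝ (Fin 3) =>
        ((cylRadius p.2 ^ 2)⁻¹ * ⟪rotGen p.2, uncurry v p⟫ ^ 2) *
          (2 * ((cylRadius p.2 ^ 2)⁻¹ * ⟪rotGen p.2, uncurry v p⟫) * ⟪rotGen p.2, uncurry w p⟫))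
        (Ioo 0 T ×ˢ {x | cylRadius x ≠ 0}) := by
      have c1 : ContinuousOn (fun p : ℝ × EuclideanSpace ℝ (Fin 3) => ⟪rotGen p.2, uncurry v p⟫)
          (Ioo 0 T ×ˢ {x | cylRadius x ≠ 0}) := ca.continuousOn.inner (cv.mono hsub)
      have c2 : ContinuousOn (fun p : ℝ × EuclideanSpace ℝ (Fin 3) => ⟪rotGen p.2, uncurry w p⟫)
          (Ioo 0 T ×ˢ {x | cylRadius x ≠ 0}) := ca.continuousOn.inner (cw.mono hsub)
      exact (cr.mul (c1.pow 2)).mul (((cr.mul c1).const_smul (2:ℝ) |>.congr fun p _ => by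
        simp [smul_eq_mul]).mul c2)
    refine cF.congr fun p hp => ?_
    obtain ⟨t, x⟩ := p
    have ht : t ∈ Icc 0 T := Ioo_subset_Icc_self hp.1
    simp only [uncurry_apply_pair]
    rw [hgrep t ht x hp.2, hg'rep t ht x hp.2]
  -- time lines off the axis
  have tl : ∀ {u : ℝ → EuclideanSpace ℝ (Fin 3) → EuclideanSpace ℝ (Fin 3)},
      ContinuousOn (uncurry u) (Icc 0 T ×ˢ univ) → ∀ x, ContinuousOn (fun s => u s x) (Icc 0 T) := by
    intro u hu x
    exact hu.comp (continuous_id.prodMk continuous_const).continuousOn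
      fun s hs => mk_mem_prod hs (mem_univ x)
  have hline : ∀ᵐ x ∂(volume : Measure (EuclideanSpace ℝ (Fin 3))),
      ContinuousOn (fun t => g t x) (Icc 0 T) ∧ ContinuousOn (fun t => g' t x) (Icc 0 T) ∧
      ∀ t ∈ Ioo 0 T, HasDerivAt (fun t => g t x) (g' t x) t := by
    have hae : ∀ᵐ x ∂(volume : Measure (EuclideanSpace ℝ (Fin 3))), cylRadius x ≠ 0 := by
      rw [ae_iff]; simp only [ne_eq, not_not]; exact volume_setOf_cylRadius_eq_zero
    filter_upwards [hae] with x hx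
    have cvx : ContinuousOn (fun s => v s x) (Icc 0 T) := tl hsm.continuousOn x
    have cwx : ContinuousOn (fun s => w s x) (Icc 0 T) := tl hwsm.continuousOn x
    set G : ℝ → ℝ := fun s => (cylRadius x ^ 2)⁻¹ * ⟪rotGen x, v s x⟫ ^ 2 with hG
    set G' : ℝ → ℝ := fun s => 2 * ((cylRadius x ^ 2)⁻¹ * ⟪rotGen x, v s x⟫) * ⟪rotGen x, w s x⟫ with hG'
    have cG : ContinuousOn G (Icc 0 T) :=
      continuousOn_const.mul (((continuous_const.inner continuous_id).comp_continuousOn cvx).pow 2)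
    have cG' : ContinuousOn G' (Icc 0 T) :=
      (continuousOn_const.mul (continuousOn_const.mul ((continuous_const.inner continuous_id).comp_continuousOn
        cvx))).mul ((continuous_const.inner continuous_id).comp_continuousOn cwx)
    refine ⟨cG.congr fun s hs => hgrep s hs x hx, cG'.congr fun s hs => hg'rep s hs x hx, fun t ht => ?_⟩
    have htI : t ∈ Icc 0 T := Ioo_subset_Icc_self ht
    have hdv : HasDerivWithinAt (fun s => v s x) (w t x) (Icc 0 T) t := by
      simp only [hw]; rw [timeDerivWithin_apply]
      exact (hsm.differentiableWithinAt_time htI x).hasDerivWithinAt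
    have hdv' : HasDerivAt (fun s => v s x) (w t x) t := hdv.hasDerivAt (Icc_mem_nhds ht.1 ht.2)
    have h1 : HasDerivAt (fun s => ⟪rotGen x, v s x⟫) ⟪rotGen x, w t x⟫ t := by
      have := (innerSL ℝ (rotGen x)).hasFDerivAt.comp_hasDerivAt t hdv'
      simpa [Function.comp_def] using this
    have h2 : HasDerivAt G (G' t) t := by
      have h3 := (h1.pow 2).const_mul ((cylRadius x ^ 2)⁻¹)
      refine h3.congr_deriv ?_
      simp only [hG', Nat.reduceSub, pow_one, Nat.cast_ofNat]
      ring
    have heq : (fun s => g s x) =ᶠ[𝓝 t] G := by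
      filter_upwards [Icc_mem_nhds ht.1 ht.2] with s hs
      exact hgrep s hs x hx
    rw [hg'rep t htI x hx]
    exact h2.congr_of_eventuallyEq heq
  -- square-integrability of the slices
  have hsq : ∀ t ∈ Icc 0 T, Integrable (fun x => g t x ^ 2) := by
    intro t ht
    have hm : MemLp (angVelQuot (v t)) 2 volume := memLp_two_of_lintegral_sq_le_coe (hΦc t ht) (hΦb t ht)
    refine ((hm.integrable_sq).const_mul (M ^ 2)).mono' (((hΓc t ht).mul (hΦc t ht)).pow 2).aestronglyMeasurable
      (Eventually.of_forall fun x => ?_)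
    simp only [hg]
    rw [Real.norm_eq_abs, abs_of_nonneg (sq_nonneg _), mul_pow]
    have h1 : swirl (v t) x ^ 2 ≤ M ^ 2 := by
      rw [← sq_abs]; exact pow_le_pow_left₀ (abs_nonneg _) (hbd t ht x) 2
    exact mul_le_mul_of_nonneg_right h1 (sq_nonneg _)
  -- conclusions
  have hK : ENNReal.ofReal (2 * M ^ 2) * ((C₁ : ℝ≥0∞) + C₂) ≠ ⊤ :=
    ENNReal.mul_ne_top ENNReal.ofReal_ne_top (by simp)
  have hInt : IntegrableOn (fun t => ∫ x, g t x * g' t x) (Ioo 0 T) :=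
    integrableOn_integral_of_lintegral_le hmeas hK fun t ht => hbound t (Ioo_subset_Icc_self ht)
  have hpair : ∀ t ∈ Icc 0 T, ∫ x, g t x * g' t x =
      2 * ∫ x, swirl (v t) x ^ 2 * angVelQuot (v t) x * angVelQuot (w t) x := by
    intro t ht
    rw [← integral_const_mul]
    exact integral_congr_ae (Eventually.of_forall fun x => hgg' t ht x)
  refine ⟨?_, fun b hb => ?_⟩
  · have : IntegrableOn (fun t => (1 / 2 : ℝ) * ∫ x, g t x * g' t x) (Ioo 0 T) := hInt.const_mul _
    refine this.congr_fun (fun t ht => ?_) measurableSet_Ioo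
    simp only
    rw [hpair t (Ioo_subset_Icc_self ht)]; ring
  · have hbal := integral_sq_eq_add_of_ae_hasDerivAt hline hmeas hK
      (fun t ht => hbound t (Ioo_subset_Icc_self ht)) hsq hb
    have e1 : ∀ s, ∫ x, g s x ^ 2 = ∫ x, swirl (v s) x ^ 2 * angVelQuot (v s) x ^ 2 := fun s =>
      integral_congr_ae (Eventually.of_forall fun x => by simp only [hg]; ring)
    rw [← e1, ← e1, hbal]
    have e2 : ∫ t in Ioo 0 b, ∫ x, g t x * g' t x =
        ∫ t in Ioo 0 b, 2 * ∫ x, swirl (v t) x ^ 2 * angVelQuot (v t) x * angVelQuot (w t) x :=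
      setIntegral_congr_fun measurableSet_Ioo fun t ht =>
        hpair t ⟨ht.1.le, ht.2.le.trans hb.2⟩
    rw [e2, integral_const_mul]
    ring

end Balance

end Literature.Analysis.FluidPDE
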